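import Mathlib

/-!
# Crux `BinomialElusive.BinomialCandidate` (stmt-ValiantsHypothesis-7392), line `registered`,
# skeleton v4 — the stub `stub_expoGrowth`: growth of the exponent family of the binomial curve

The route's binomial curve at arity `m` has exponents
`E_m(j) = Σ_{k ≤ h} (j · M)^k`, with `h = ⌊log₂ m⌋²` and `M = (2m+2)^{h+1}`.
The registered stub `stub_expoGrowth` of skeleton v4 records two elementary growth facts about
this family, for all `m ≥ m₀ := 128`:

* strict monotonicity in `j`: `E_m(j) < E_m(j+1)` — termwise `(jM)^k ≤ ((j+1)M)^k`, strict at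
  `k = 1` (which is in range as `h ≥ 1`); see `ExpoGrowth.geom_sum_lt_of_lt`;
* for every index `τ < m` there is an index `i ≠ τ`, `i < m`, with `E_m(2τ+2) < 2 E_m(2i+2)`:
  if `τ` is not the top index take `i = m - 1` and use monotonicity; if `τ = m - 1` take
  `i = m - 2` and compare termwise, `((2m) M)^k ≤ 2 ((2m-2) M)^k` for `k ≤ h`, strict at `k = 0`
  (`ExpoGrowth.geom_sum_lt_two_mul`). The termwise bound is `m^k ≤ 2 (m-1)^k` for `2k ≤ m - 1`,
  which follows from the integer inequality `(n+1)^k (n-k) ≤ n^{k+1}` (`k ≤ n`,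
  `ExpoGrowth.succ_pow_mul_sub_le`, induction on `k`). The side condition `2h ≤ m - 1` holds for
  `m ≥ 128`: `L = ⌊log₂ m⌋ ≥ 7`, `2^L ≤ m` and `2L² + 1 ≤ 2^L` for `L ≥ 7`
  (`ExpoGrowth.log_sq_bounds`).

Everything is Mathlib-only natural-number arithmetic; the threshold is `m₀ = 128`.
-/

-- layout Summits/ValiantsHypothesis/ValiantsHypothesis forces the duplicated namespace component
set_option linter.dupNamespace false

namespace Summit.ValiantsHypothesis.ValiantsHypothesis.Theorems.BinomialCandidateStubs

open scoped BigOperators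

namespace ExpoGrowth

/-- Strict monotonicity in `j` of the geometric sums `Σ_{k ≤ h} (j M)^k`, for `M, h ≥ 1`. -/
theorem geom_sum_lt_of_lt (M h j j' : ℕ) (hM : 1 ≤ M) (hh : 1 ≤ h) (hjj' : j < j') :
    ∑ k ∈ Finset.range (h + 1), (j * M) ^ k < ∑ k ∈ Finset.range (h + 1), (j' * M) ^ k := by
  apply Finset.sum_lt_sum
  · intro k _
    exact Nat.pow_le_pow_left (Nat.mul_le_mul_right _ hjj'.le) k
  · refine ⟨1, Finset.mem_range.mpr (by omega), ?_⟩
    rw [pow_one, pow_one]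
    exact Nat.mul_lt_mul_of_pos_right hjj' (by omega)

/-- The integer inequality `(n+1)^k (n-k) ≤ n^{k+1}` for `k ≤ n` (a truncated Bernoulli bound). -/
theorem succ_pow_mul_sub_le (n : ℕ) : ∀ k : ℕ, k ≤ n → (n + 1) ^ k * (n - k) ≤ n ^ (k + 1)
  | 0, _ => by simp
  | k + 1, hk => by
    have ih := succ_pow_mul_sub_le n k (Nat.le_of_succ_le hk)
    have key : (n + 1) * (n - (k + 1)) ≤ n * (n - k) := by
      obtain ⟨d, rfl⟩ := Nat.exists_eq_add_of_le hk
      have h1 : k + 1 + d - (k + 1) = d := by omega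
      have h2 : k + 1 + d - k = d + 1 := by omega
      rw [h1, h2]
      nlinarith
    calc (n + 1) ^ (k + 1) * (n - (k + 1)) = (n + 1) ^ k * ((n + 1) * (n - (k + 1))) := by ring
      _ ≤ (n + 1) ^ k * (n * (n - k)) := Nat.mul_le_mul_left _ key
      _ = n * ((n + 1) ^ k * (n - k)) := by ring
      _ ≤ n * n ^ (k + 1) := Nat.mul_le_mul_left _ ih
      _ = n ^ (k + 1 + 1) := by ring

/-- The top comparison: `Σ_{k ≤ h} ((2n+2) M)^k < 2 Σ_{k ≤ h} ((2n) M)^k` when `2h ≤ n`;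
termwise `((2n+2) M)^k ≤ 2 ((2n) M)^k`, i.e. `(n+1)^k ≤ 2 n^k` for `2k ≤ n`, strict at `k = 0`. -/
theorem geom_sum_lt_two_mul (M h n : ℕ) (hn : 2 * h ≤ n) :
    ∑ k ∈ Finset.range (h + 1), ((2 * n + 2) * M) ^ k <
      2 * ∑ k ∈ Finset.range (h + 1), (2 * n * M) ^ k := by
  rw [Finset.mul_sum]
  apply Finset.sum_lt_sum
  · intro k hk
    have hk' : 2 * k ≤ n := by
      have := Finset.mem_range.mp hk
      omega
    -- the termwise bound `(n+1)^k ≤ 2 n^k`: from `succ_pow_mul_sub_le`, cancelling `n - k > 0`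
    have hb : (n + 1) ^ k ≤ 2 * n ^ k := by
      rcases Nat.eq_zero_or_pos k with rfl | _
      · norm_num
      · refine Nat.le_of_mul_le_mul_right ?_ (show 0 < n - k by omega)
        calc (n + 1) ^ k * (n - k) ≤ n ^ (k + 1) := succ_pow_mul_sub_le n k (by omega)
          _ = n ^ k * n := pow_succ n k
          _ ≤ n ^ k * (2 * (n - k)) := Nat.mul_le_mul_left _ (by omega)
          _ = 2 * n ^ k * (n - k) := by ring
    calc ((2 * n + 2) * M) ^ k = (n + 1) ^ k * (2 * M) ^ k := by
          rw [show (2 * n + 2) * M = (n + 1) * (2 * M) by ring, mul_pow]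
      _ ≤ 2 * n ^ k * (2 * M) ^ k := Nat.mul_le_mul_right _ hb
      _ = 2 * (2 * n * M) ^ k := by
          rw [show 2 * n * M = n * (2 * M) by ring, mul_pow n (2 * M) k, mul_assoc]
  · exact ⟨0, Finset.mem_range.mpr (Nat.succ_pos h), by norm_num⟩

/-- `2 L² + 1 ≤ 2^L` for `L ≥ 7`. -/
theorem two_mul_sq_succ_le_two_pow (L : ℕ) (hL : 7 ≤ L) : 2 * L ^ 2 + 1 ≤ 2 ^ L := by
  induction L, hL using Nat.le_induction with
  | base => norm_num
  | succ L hL ih =>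
    calc 2 * (L + 1) ^ 2 + 1 ≤ 2 * (2 * L ^ 2 + 1) := by nlinarith
      _ ≤ 2 * 2 ^ L := Nat.mul_le_mul_left 2 ih
      _ = 2 ^ (L + 1) := by rw [pow_succ']

/-- For `m ≥ 128`: `1 ≤ ⌊log₂ m⌋²` and `2 ⌊log₂ m⌋² + 1 ≤ m`. -/
theorem log_sq_bounds (m : ℕ) (hm : 128 ≤ m) :
    1 ≤ Nat.log 2 m ^ 2 ∧ 2 * Nat.log 2 m ^ 2 + 1 ≤ m := by
  have hL : 7 ≤ Nat.log 2 m := Nat.le_log_of_pow_le (by norm_num) hm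
  refine ⟨Nat.one_le_pow _ _ (by omega), ?_⟩
  calc 2 * Nat.log 2 m ^ 2 + 1 ≤ 2 ^ Nat.log 2 m := two_mul_sq_succ_le_two_pow _ hL
    _ ≤ m := Nat.pow_log_le_self 2 (by omega)

end ExpoGrowth

/-- **Registered stub `stub_expoGrowth`** (skeleton v4 of the line `registered`, crux
`BinomialElusive.BinomialCandidate`): for `m ≥ 128`, with `h = ⌊log₂ m⌋²` and `M = (2m+2)^{h+1}`,
the exponents `E_m(j) = Σ_{k ≤ h} (jM)^k` are strictly increasing in `j`, and for every index
`τ < m` some index `i ≠ τ`, `i < m`, satisfies `E_m(2τ+2) < 2 E_m(2i+2)`. -/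
theorem stub_expoGrowth :
    ∃ m₀ : ℕ, ∀ m ≥ m₀,
      (∀ j : ℕ, (∑ k ∈ Finset.range (Nat.log 2 m ^ 2 + 1), (j * (2 * m + 2) ^ (Nat.log 2 m ^ 2 + 1)) ^ k) <
          ∑ k ∈ Finset.range (Nat.log 2 m ^ 2 + 1), ((j + 1) * (2 * m + 2) ^ (Nat.log 2 m ^ 2 + 1)) ^ k) ∧
      (∀ τ : Fin m, ∃ i : Fin m, i ≠ τ ∧
        (∑ k ∈ Finset.range (Nat.log 2 m ^ 2 + 1), ((2 * (τ : ℕ) + 2) * (2 * m + 2) ^ (Nat.log 2 m ^ 2 + 1)) ^ k) <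
          2 * ∑ k ∈ Finset.range (Nat.log 2 m ^ 2 + 1),
            ((2 * (i : ℕ) + 2) * (2 * m + 2) ^ (Nat.log 2 m ^ 2 + 1)) ^ k) := by
  refine ⟨128, fun m hm => ?_⟩
  obtain ⟨hh1, hhm⟩ := ExpoGrowth.log_sq_bounds m hm
  generalize Nat.log 2 m ^ 2 = h at hh1 hhm ⊢
  have hM : 1 ≤ (2 * m + 2) ^ (h + 1) := Nat.one_le_pow _ _ (by omega)
  generalize (2 * m + 2) ^ (h + 1) = M at hM ⊢
  refine ⟨fun j => ExpoGrowth.geom_sum_lt_of_lt M h j (j + 1) hM hh1 (Nat.lt_succ_self j),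
    fun τ => ?_⟩
  have hτm : (τ : ℕ) < m := τ.isLt
  by_cases hτ : (τ : ℕ) + 1 < m
  · refine ⟨⟨m - 1, by omega⟩, Fin.ne_of_val_ne (by dsimp only; omega), ?_⟩
    calc ∑ k ∈ Finset.range (h + 1), ((2 * (τ : ℕ) + 2) * M) ^ k
        < ∑ k ∈ Finset.range (h + 1), ((2 * (m - 1) + 2) * M) ^ k :=
          ExpoGrowth.geom_sum_lt_of_lt M h _ _ hM hh1 (by omega)
      _ ≤ 2 * ∑ k ∈ Finset.range (h + 1), ((2 * (m - 1) + 2) * M) ^ k :=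
          Nat.le_mul_of_pos_left _ (by norm_num)
  · refine ⟨⟨m - 2, by omega⟩, Fin.ne_of_val_ne (by dsimp only; omega), ?_⟩
    show ∑ k ∈ Finset.range (h + 1), ((2 * (τ : ℕ) + 2) * M) ^ k <
      2 * ∑ k ∈ Finset.range (h + 1), ((2 * (m - 2) + 2) * M) ^ k
    have e1 : 2 * (τ : ℕ) + 2 = 2 * (m - 1) + 2 := by omega
    have e2 : 2 * (m - 2) + 2 = 2 * (m - 1) := by omega
    rw [e1, e2]
    exact ExpoGrowth.geom_sum_lt_two_mul M h (m - 1) (by omega)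

end Summit.ValiantsHypothesis.ValiantsHypothesis.Theorems.BinomialCandidateStubs
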